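import Literature.AlgebraicGeometry.Resolution.KollarSurfaceOrderReductionTameSurface
import Literature.AlgebraicGeometry.Resolution.MaximalContactChartsTransport
import Literature.AlgebraicGeometry.Resolution.BlowupSequencesLocalIsoDescent
import Literature.AlgebraicGeometry.Resolution.BlowupSequencesOffCentres
import Literature.AlgebraicGeometry.Resolution.MaximalContactRegular
import Literature.AlgebraicGeometry.Resolution.KollarBoundaryFold
import Literature.AlgebraicGeometry.Resolution.KollarCoverTriples
import Literature.AlgebraicGeometry.Resolution.SigmaMaxEliminationInDim
import HarnessLib

/-!
# The curve part of a tame cosupport on a surface is an admissible centre for a simple normal crossing boundary in chart position (Kollár 2007, 3.111 Step 1 with 3.104 Step 2.1)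

Topic: `Literature/AlgebraicGeometry/Resolution`. J. Kollár, *Lectures on Resolution of
Singularities* (2007), 3.111 Step 1 (p. 176 of the held copy: the codimension-one part `W` of
the cosupport of a marked ideal of maximal order `m` is smooth with `I = I_W^m` along it and is
blown up first) combined with 3.104 Step 2.1 (after Lemma 3.102 the boundary members through the
cosupport are new exceptional divisors transversal to the hypersurfaces of maximal contact).
`KollarSurfaceOrderReductionTameSurface.lean` does Step 1 on a surface in the tame regime
`b < p` with EMPTY boundary (`curvePart_pointwise`, `exists_isResolutionOf_of_hypersurface_part`).
This file PROVES the boundary version: if every point of the cosupport carries a local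
maximal-contact chart in simple normal crossing position with the sub-boundary `B ⊆ E` of the
members that meet the cosupport, then the curve part `C` (locally the chart's curve) has simple
normal crossings with `E`, its blowing up is admissible, and afterwards the cosupport is a finite
set of closed points of dimension `≤ 2`.

* `HasSNC.hasSNCWith_of_charts` — simple normal crossings of a centre with an snc boundary is a
  local property: it may be checked after pulling back to open neighbourhoods `j : V → X` of the
  points of the centre (transport of adapted regular systems of parameters along
  `𝒪_{X, j v} ≅ 𝒪_{V, v}`, as in `HasSNCWith.of_comap_of_isLocalIso`);
* `hasSNCWith_of_chart_eq` — on a chart: if `H + L` is snc, the members of `E'` through `V(C)`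
  belong to `L` and `C` has the stalks of `H` along `V(C)`, then `C` has snc with `E'`;
* `stalkIdeal_eq_of_le_of_generators` — `H ⊆ P`, both with order-one stalk generators at a point
  of `V(P)`: equal stalks;
* `CentreSeq.dominated_transformMarked` — "the members through the cosupport belong to the
  sub-boundary" persists along admissible sequences;
* **`Kollar2007.curvePart_admissible_of_charts`** — the blow-up of the curve part is admissible
  for `(X, I, E, b)` and leaves a finite cosupport of closed points of dimension `≤ 2`.

## Sources

* J. Kollár, *Lectures on Resolution of Singularities*, Ann. of Math. Stud. 166 (2007): 3.111
  Step 1 (p. 176), 3.104 Steps 2.1–2.2 (pp. 172–173), Thm. 3.80. [Kollar2007]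
* E. Bierstone, D. Grigoriev, P. Milman, J. Włodarczyk, arXiv:1206.3090: Def. 3.1.1, 3.1.3,
  Lemma 3.6.4 (2), Thm. 8.0.4. [BierstoneGrigorievMilmanWlodarczyk2011]
-/

noncomputable section

open CategoryTheory CategoryTheory.Limits AlgebraicGeometry TopologicalSpace IsLocalRing
  Scheme.IdealSheafData

namespace Literature.AlgebraicGeometry.Resolution

universe u v

/-! ## Simple normal crossings of a centre are local -/

/-- **Simple normal crossings of a centre with an snc boundary may be checked on open charts
around the points of the centre** (BGMW Def. 3.1.3 (2) is a condition on the local rings): if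
`E` has simple normal crossings and every point of `V(C)` is the image of a point `v` of an open
immersion `j : V → X` with `E|_V` having simple normal crossings with `C|_V`, then `E` has simple
normal crossings with `C`. The adapted regular system of parameters of `𝒪_{V,v}` transports along
`𝒪_{X, j v} ≅ 𝒪_{V,v}`; distinct members of `E` through `j v` keep distinct parameters because
they have distinct stalks (`HasSNCWith.stalkIdeal_ne_of_ne`).
[cite: BierstoneGrigorievMilmanWlodarczyk2011, Def. 3.1.1, Def. 3.1.3 (2)] -/
theorem HasSNC.hasSNCWith_of_charts {X : Scheme.{u}} {E : List X.IdealSheafData} (hE : HasSNC E)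
    {C : X.IdealSheafData}
    (h : ∀ x ∈ C.support, ∃ (V : Scheme.{u}) (j : V ⟶ X) (_ : IsOpenImmersion j) (v : V),
      j v = x ∧ HasSNCWith (E.map (·.comap j)) (C.comap j)) :
    HasSNCWith E C := by
  classical
  intro x
  by_cases hx : x ∈ C.support
  swap
  · obtain ⟨hreg, u, hu, hι, -⟩ := hE x
    exact ⟨hreg, u, hu, hι, fun h' => (hx h').elim⟩
  obtain ⟨V, j, hj, v, rfl, hV⟩ := h x hx
  obtain ⟨hreg', u', hu', ⟨ι', hι', hι'D⟩, hC'⟩ := hV v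
  haveI := hreg'
  set e := stalkEquivOfIsLocalIso j v with he_def
  haveI hreg : IsRegularLocalRing (X.presheaf.stalk (j v)) := IsRegularLocalRing.of_ringEquiv e.symm
  refine ⟨hreg, ?_⟩
  have hrank : (maximalIdeal (X.presheaf.stalk (j v))).spanFinrank =
      (maximalIdeal (V.presheaf.stalk v)).spanFinrank := by
    rw [← map_ringEquiv_maximalIdeal e, Ideal.spanFinrank_map_eq_of_ringEquiv]
  let σ : Fin (maximalIdeal (X.presheaf.stalk (j v))).spanFinrank ≃
      Fin (maximalIdeal (V.presheaf.stalk v)).spanFinrank := finCongr hrank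
  let u : Fin (maximalIdeal (X.presheaf.stalk (j v))).spanFinrank → X.presheaf.stalk (j v) :=
    fun i => e.symm (u' (σ i))
  have huσ : ∀ l, u (σ.symm l) = e.symm (u' l) := fun l => by
    simp only [u, Equiv.apply_symm_apply]
  refine ⟨u, ?_, ?_, ?_⟩
  · have hr : Set.range u = e.symm '' Set.range u' := by
      rw [show u = (fun l => e.symm (u' l)) ∘ σ from rfl, σ.surjective.range_comp]
      exact Set.range_comp _ u'
    rw [hr, ← Ideal.map_span e.symm, hu', map_ringEquiv_maximalIdeal]
  · let θ : {D // D ∈ E ∧ j v ∈ D.support} → {D' // D' ∈ E.map (·.comap j) ∧ v ∈ D'.support} :=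
      fun D => ⟨D.1.comap j, List.mem_map.mpr ⟨D.1, D.2.1, rfl⟩, by
        rw [Scheme.IdealSheafData.support_comap]; exact D.2.2⟩
    have hstalk : ∀ D : {D // D ∈ E ∧ j v ∈ D.support},
        stalkIdeal D.1 (j v) = Ideal.span {u (σ.symm (ι' (θ D)))} := fun D => by
      rw [huσ, stalkIdeal_eq_map_symm_of_isLocalIso j, ← he_def,
        show stalkIdeal (D.1.comap j) v = Ideal.span {u' (ι' (θ D))} from hι'D (θ D), Ideal.map_span,
        Set.image_singleton]
    refine ⟨fun D => σ.symm (ι' (θ D)), fun D₁ D₂ heq => ?_, hstalk⟩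
    by_contra hne
    have hne' : D₁.1 ≠ D₂.1 := fun h' => hne (Subtype.ext h')
    have hst : stalkIdeal D₁.1 (j v) = stalkIdeal D₂.1 (j v) := by
      rw [hstalk D₁, hstalk D₂, show σ.symm (ι' (θ D₁)) = σ.symm (ι' (θ D₂)) from heq]
    exact (HasSNCWith.stalkIdeal_ne_of_ne hE D₁.2.1 D₂.2.1 hne' D₁.2.2 D₂.2.2) hst
  · intro _
    have hv : v ∈ (C.comap j).support := by
      rw [Scheme.IdealSheafData.support_comap]; exact hx
    obtain ⟨S, hS⟩ := hC' hv
    refine ⟨σ ⁻¹' S, ?_⟩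
    rw [stalkIdeal_eq_map_symm_of_isLocalIso j, ← he_def, hS, Ideal.map_span, Set.image_image]
    congr 1
    rw [show u = (fun l => e.symm (u' l)) ∘ σ from rfl, Set.image_comp, σ.image_preimage]

/-- **On a chart**: if `H + L` is a simple normal crossing divisor, `E'` is one, every member of
`E'` through a point of `V(C)` belongs to `L`, and along `V(C)` the ideal `C` has the stalks of
`H` (so `V(C) ⊆ V(H)`), then `C` has simple normal crossings with `E'`.
[cite: Kollar2007, 3.104 Step 2.1 (p. 172)] [cite: BierstoneGrigorievMilmanWlodarczyk2011, Def. 3.1.3 (2)] -/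
theorem hasSNCWith_of_chart_eq {V : Scheme.{u}} {L E' : List V.IdealSheafData}
    {H C : V.IdealSheafData} (hsnc : HasSNC (H :: L)) (hE' : HasSNC E')
    (hdom : ∀ v ∈ C.support, ∀ D ∈ E', v ∈ D.support → D ∈ L)
    (hCH : ∀ v ∈ C.support, v ∈ H.support ∧ stalkIdeal C v = stalkIdeal H v) :
    HasSNCWith E' C := by
  intro v
  by_cases hv : v ∈ C.support
  · obtain ⟨hvH, hCv⟩ := hCH v hv
    obtain ⟨hreg, u, hu, ⟨ι, hι, hιD⟩, -⟩ := hsnc v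
    have hHmem : H ∈ H :: L := List.mem_cons_self
    refine ⟨hreg, u, hu, ⟨fun D => ι ⟨D.1, List.mem_cons_of_mem _ (hdom v hv D.1 D.2.1 D.2.2), D.2.2⟩,
      fun D₁ D₂ heq => ?_, fun D => hιD ⟨D.1, List.mem_cons_of_mem _ (hdom v hv D.1 D.2.1 D.2.2), D.2.2⟩⟩,
      fun _ => ⟨{ι ⟨H, hHmem, hvH⟩}, ?_⟩⟩
    · have h := congrArg Subtype.val (hι heq)
      exact Subtype.ext h
    · rw [Set.image_singleton, hCv]
      exact hιD ⟨H, hHmem, hvH⟩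
  · obtain ⟨hreg, u, hu, hι, -⟩ := hE' v
    exact ⟨hreg, u, hu, hι, fun h => (hv h).elim⟩

/-- **Two regular hypersurface ideals, one inside the other, agree at a common point**: if
`H ⊆ P`, `H_v = (u)` with `u ∉ 𝔪_v²` and `v ∈ V(P)`, then `P_v = H_v` (write `u = a·w` for a
generator `w ∈ 𝔪_v` of `P_v`; `a` is a unit as `u ∉ 𝔪_v²`). [cite: Kollar2007, 3.111 Step 1 (p. 176)] -/
theorem stalkIdeal_eq_of_le_of_generators {V : Scheme.{u}} {H P : V.IdealSheafData} (hle : H ≤ P)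
    {v : V} (hvP : v ∈ P.support)
    (hH : ∃ u : V.presheaf.stalk v, stalkIdeal H v = Ideal.span {u} ∧ u ∉ (maximalIdeal _) ^ 2)
    (hP : ∃ w : V.presheaf.stalk v, stalkIdeal P v = Ideal.span {w} ∧ w ∉ (maximalIdeal _) ^ 2) :
    stalkIdeal P v = stalkIdeal H v := by
  obtain ⟨u, hu, hu2⟩ := hH
  obtain ⟨w, hw, -⟩ := hP
  have hwm : w ∈ maximalIdeal _ :=
    (mem_support_iff_stalkIdeal_le P v).mp hvP (hw ▸ Ideal.mem_span_singleton_self w)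
  have huw : u ∈ Ideal.span {w} := by
    rw [← hw]
    exact stalkIdeal_mono hle v (hu ▸ Ideal.mem_span_singleton_self u)
  obtain ⟨a, rfl⟩ := Ideal.mem_span_singleton'.mp huw
  have ha : IsUnit a := by
    by_contra ha
    apply hu2
    rw [pow_two]
    exact Ideal.mul_mem_mul ((mem_maximalIdeal _).mpr ha) hwm
  rw [hu, hw]
  exact (Ideal.span_singleton_mul_left_unit ha w).symm

/-! ## Domination of the boundary by a sub-boundary persists -/

namespace CentreSeq

/-- **"Every boundary member through the cosupport belongs to the sub-boundary `B`" persists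
along blow-up sequences admissible for `(I, B, μ)`**: a birational transform through a point of
the cosupport lies over its divisor and the cosupport over the cosupport, and the new exceptional
members are common to both boundaries. [cite: Kollar2007, 3.104 Step 2.2 (p. 173)] -/
theorem dominated_transformMarked : ∀ {X : Scheme.{u}} [IsLocallyNoetherian X] (s : CentreSeq X)
    {I : X.IdealSheafData} {E B : List X.IdealSheafData} {μ : ℕ},
    (∀ x ∈ (⟨I, B, μ⟩ : MarkedIdeal X).support, ∀ D ∈ E, x ∈ D.support → D ∈ B) →
    s.IsAdmissibleFor ⟨I, B, μ⟩ →
    ∀ y ∈ (s.transformMarked ⟨I, B, μ⟩).support, ∀ D' ∈ (s.transformMarked ⟨I, E, μ⟩).boundary,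
      y ∈ D'.support → D' ∈ (s.transformMarked ⟨I, B, μ⟩).boundary
  | _, _, nil _, _, _, _, _, hdom, _ => hdom
  | X, _, cons C rest, I, E, B, μ, hdom, h => by
    haveI : IsLocallyNoetherian (blowup C) := isLocallyNoetherian_blowup C
    obtain ⟨hC, -, -, hrest⟩ := h
    have e₁ : (⟨I, E, μ⟩ : MarkedIdeal X).transform (blowup.π C) C =
        ⟨controlledTransform (blowup.π C) C I μ, ((⟨I, E, μ⟩ : MarkedIdeal X).transform (blowup.π C) C).boundary, μ⟩ := rfl
    have e₂ : (⟨I, B, μ⟩ : MarkedIdeal X).transform (blowup.π C) C =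
        ⟨controlledTransform (blowup.π C) C I μ, ((⟨I, B, μ⟩ : MarkedIdeal X).transform (blowup.π C) C).boundary, μ⟩ := rfl
    change ∀ y ∈ (rest.transformMarked ((⟨I, B, μ⟩ : MarkedIdeal X).transform (blowup.π C) C)).support,
      ∀ D' ∈ (rest.transformMarked ((⟨I, E, μ⟩ : MarkedIdeal X).transform (blowup.π C) C)).boundary,
        y ∈ D'.support → D' ∈ (rest.transformMarked ((⟨I, B, μ⟩ : MarkedIdeal X).transform (blowup.π C) C)).boundary
    rw [e₁, e₂]
    rw [e₂] at hrest
    refine dominated_transformMarked rest ?_ hrest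
    intro x' hx' D' hD' hxD'
    rw [MarkedIdeal.transform_boundary] at hD' ⊢
    rcases List.mem_append.mp hD' with hD' | hD'
    · obtain ⟨D, hD, rfl⟩ := List.mem_map.mp hD'
      refine List.mem_append_left _ (List.mem_map.mpr ⟨D, ?_, rfl⟩)
      have hx : blowup.π C x' ∈ (⟨I, B, μ⟩ : MarkedIdeal X).support :=
        MarkedIdeal.support_transform_subset_preimage (blowup.isBlowup C) ⟨I, B, μ⟩ hC
          (by rw [e₂]; exact hx')
      have hxD : blowup.π C x' ∈ D.support := by
        have h1 := (support_strictTransformIdeal_subset (π := blowup.π C) (C := C) D) hxD'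
        exact support_controlledTransform_subset_preimage (π := blowup.π C) (C := C) D 1 h1
      exact hdom _ hx D hD hxD
    · exact List.mem_append_right _ hD'

end CentreSeq

/-! ## The curve part, with boundary -/

namespace Kollar2007

variable (k : Type u) [Field k] (X : Scheme.{u}) [X.Over (Spec (.of k))]

/-- **The curve part of a tame cosupport is an admissible centre for an snc boundary in chart
position, and its blowing up leaves finitely many points** (Kollár 3.111 Step 1 with 3.104 Step
2.1, surfaces, tame regime). Let `X` be smooth over a perfect field `k` of characteristic `p`
(`p = 0` allowed), Noetherian of dimension `≤ 2`; `(I, E, b)` with `E` snc, `max-ord I ≤ b`,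
`1 ≤ b`, `p = 0 ∨ b < p`; `B ⊆ E` a sub-boundary containing every member of `E` through a point
of the cosupport; and around every point of the cosupport an open `j : V → X` with
`H ⊆ 𝒟^{b-1}(I|_V)` having order-one stalk generators and `H + B|_V` snc. Let `C` be the closure
of the non-closed points of the cosupport and `P = 𝓘_C` (the witness of the existential). Then: `P` has order-one stalk generators
and `I = P^b` along `C` (`curvePart_pointwise`); `C` has simple normal crossings with `E`
(locally `P = H`, `hasSNCWith_of_charts`); the one-step sequence blowing up `C` is admissible for
`(X, I, E, b)`; and the cosupport of the transform is a finite set of closed points of dimension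
`≤ 2` (it lies, isomorphically, over `cosupp ∖ C`). [cite: Kollar2007, 3.111 Step 1 (p. 176), 3.104 Step 2.1 (p. 172)]
[cite: BierstoneGrigorievMilmanWlodarczyk2011, Def. 3.1.3, Thm. 8.0.4] -/
theorem curvePart_admissible_of_charts (p : ℕ) [CharP k p] [PerfectField k]
    [Smooth (X ↘ Spec (.of k))] [NoetherianSpace X] (hX2 : topologicalKrullDim X ≤ 2)
    (I : X.IdealSheafData) {E B : List X.IdealSheafData} (hE : HasSNC E) {b : ℕ} (hb : 1 ≤ b)
    (hbp : p = 0 ∨ b < p) (hmax : ∀ x : X, idealOrder I x ≤ b)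
    (hdom : ∀ x ∈ (⟨I, B, b⟩ : MarkedIdeal X).support, ∀ D ∈ E, x ∈ D.support → D ∈ B)
    (hch : ∀ x ∈ (⟨I, B, b⟩ : MarkedIdeal X).support, ∃ (V : Scheme.{u}) (j : V ⟶ X)
      (_ : IsOpenImmersion j) (_ : x ∈ Set.range j) (H : V.IdealSheafData),
      H ≤ derivIdealSheafIter (j.appTop.hom.comp (overHom k X)) (b - 1) (I.comap j) ∧
        (∀ v ∈ H.support, ∃ w : V.presheaf.stalk v,
          stalkIdeal H v = Ideal.span {w} ∧ w ∉ (maximalIdeal (V.presheaf.stalk v)) ^ 2) ∧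
        HasSNC (H :: B.map (·.comap j))) :
    ∃ P : X.IdealSheafData,
    (CentreSeq.cons P (CentreSeq.nil _)).IsAdmissibleFor ⟨I, E, b⟩ ∧
      (((⟨I, E, b⟩ : MarkedIdeal X).transform (blowup.π P) P).support).Finite ∧
      (∀ y ∈ ((⟨I, E, b⟩ : MarkedIdeal X).transform (blowup.π P) P).support,
        IsClosed ({y} : Set (blowup P))) ∧
      (∀ y ∈ ((⟨I, E, b⟩ : MarkedIdeal X).transform (blowup.π P) P).support,
        ringKrullDim ((blowup P).presheaf.stalk y) ≤ 2) := by
  classical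
  haveI : IsLocallyNoetherian X := isLocallyNoetherian_of_locallyOfFiniteType_over k X
  have hXreg : Scheme.IsRegular X := Scheme.isRegular_of_smooth_over_field k X
  have hfpX : ∀ ⦃Y : Scheme.{u}⦄ (g : Y ⟶ X) [LocallyOfFiniteType g],
      HasFinitePresentationDifferentials (g.appTop.hom.comp (overHom k X)) :=
    fun Y g _ => hasFinitePresentationDifferentials_appTop_comp_overHom k g
  have hXd : HasFinitePresentationDifferentials (overHom k X) := hasFinitePresentationDifferentials_overHom k X
  set M : MarkedIdeal X := ⟨I, E, b⟩ with hM
  set N : Set X := {η | η ∈ (⟨I, [], b⟩ : MarkedIdeal X).support ∧ ¬ IsClosed ({η} : Set X)} with hN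
  set P : X.IdealSheafData := vanishingIdeal ⟨closure N, isClosed_closure⟩ with hPdef
  have hPsupp : (P.support : Set X) = closure N := by
    rw [hPdef, coe_support_vanishingIdeal]; rfl
  have hF : IsClosed (⟨I, [], b⟩ : MarkedIdeal X).support :=
    MarkedIdeal.isClosed_support hXd (hasLocalCoordinates_overHom k X) _
      (fun z j hj hjb => isUnit_natCast_stalk_of_char k X p (hbp.imp id le_of_lt) z j hj hjb)
  have hCF : closure N ⊆ (⟨I, [], b⟩ : MarkedIdeal X).support := hF.closure_subset_iff.mpr fun z hz => hz.1
  -- `P` has order-one generators and `I = P^b` along `C`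
  have hP : ∀ y ∈ P.support, ∃ v : X.presheaf.stalk y,
      stalkIdeal P y = Ideal.span {v} ∧ v ∉ (maximalIdeal (X.presheaf.stalk y)) ^ 2 := fun y hy =>
    (curvePart_pointwise k X p hX2 I hb hbp hmax y (by rw [← hPsupp]; exact hy)).1
  have hIP : ∀ y ∈ P.support, stalkIdeal I y = stalkIdeal P y ^ b := fun y hy =>
    (curvePart_pointwise k X p hX2 I hb hbp hmax y (by rw [← hPsupp]; exact hy)).2
  have hPM : (P.support : Set X) ⊆ M.support := fun x hx => by
    rw [MarkedIdeal.mem_support_iff]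
    change stalkIdeal I x ≤ _
    rw [hIP x hx]
    exact Ideal.pow_right_mono ((mem_support_iff_stalkIdeal_le P x).mp hx) b
  have hPreg : Scheme.IsRegular P.subscheme := isRegular_subscheme_of_generator _ hXreg hP
  -- `C` has simple normal crossings with `E`: locally `P = H`
  have hPsnc : HasSNCWith E P := by
    refine hE.hasSNCWith_of_charts fun x hx => ?_
    have hxM : x ∈ (⟨I, B, b⟩ : MarkedIdeal X).support := hPM hx
    obtain ⟨V, j, hj, ⟨v, rfl⟩, H, hHmc, hHgen, hHsnc⟩ := hch _ hxM
    haveI : IsLocallyNoetherian V := LocallyOfFiniteType.isLocallyNoetherian j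
    have hVreg : Scheme.IsRegular V := Scheme.IsRegular.of_isOpenImmersion j hXreg
    have hVd : HasFinitePresentationDifferentials (j.appTop.hom.comp (overHom k X)) := hfpX j
    refine ⟨V, j, hj, v, rfl, ?_⟩
    -- on `V`: `P|_V ⊇ H`, hence `P|_V = H` stalkwise along `V(P|_V)`
    set P' : V.IdealSheafData := P.comap j with hP'def
    have hP'gen : ∀ w ∈ P'.support, ∃ u : V.presheaf.stalk w,
        stalkIdeal P' w = Ideal.span {u} ∧ u ∉ (maximalIdeal (V.presheaf.stalk w)) ^ 2 :=
      fun w hw => exists_generator_notMem_sq_comap_of_isLocalIso j hP w hw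
    have hP'snc0 : HasSNCWith ([] : List V.IdealSheafData) P' := by
      have h1 := (hasSNC_singleton_of_generator hVreg hP'gen).hasSNCWith_finsetSup {P'} (by simp)
      rw [Finset.sup_singleton, id] at h1
      exact h1.of_cons
    have hsuppH : (⟨I.comap j, B.map (·.comap j), b⟩ : MarkedIdeal V).support ⊆ (H.support : Set V) :=
      MarkedIdeal.support_subset_support_of_le_deriv hVd ⟨I.comap j, B.map (·.comap j), b⟩ hb hHmc
    have hP'supp : (P'.support : Set V) ⊆ H.support := by
      intro w hw
      refine hsuppH ?_
      have : (⟨I.comap j, B.map (·.comap j), b⟩ : MarkedIdeal V) = (⟨I, B, b⟩ : MarkedIdeal X).comap j := rfl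
      rw [this, MarkedIdeal.support_comap_of_isOpenImmersion]
      rw [hP'def, support_comap] at hw
      exact hPM hw
    have hHP' : H ≤ P' := le_of_support_subset_support (fun w hw => hP'snc0.isRsopGeneratedAt hw) hP'supp
    have hEV : HasSNC (E.map (·.comap j)) := by
      have := hE.comap_of_isOpenImmersion j
      rwa [Scheme.IdealSheafData.comap_top] at this
    refine hasSNCWith_of_chart_eq hHsnc hEV (fun w hw D' hD' hwD' => ?_) (fun w hw => ?_)
    · obtain ⟨D, hD, rfl⟩ := List.mem_map.mp hD'
      refine List.mem_map.mpr ⟨D, ?_, rfl⟩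
      rw [hP'def, support_comap] at hw
      rw [support_comap] at hwD'
      exact hdom _ (hPM hw) D hD hwD'
    · have hwH : w ∈ H.support := hP'supp hw
      exact ⟨hwH, stalkIdeal_eq_of_le_of_generators hHP' hw (hHgen w hwH) (hP'gen w hw)⟩
  -- the blow-up of `C` and the transformed cosupport
  set t : CentreSeq X := CentreSeq.cons P (CentreSeq.nil (blowup P)) with ht
  haveI : IsLocallyNoetherian (blowup P) := CentreSeq.isLocallyNoetherian_blowup P
  have htadm : t.IsAdmissibleFor M :=
    (CentreSeq.isAdmissibleFor_cons P _ M).mpr ⟨hPM, hPsnc, hPreg, trivial⟩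
  have htover : t.CentresOver (P.support : Set X) :=
    (CentreSeq.centresOver_cons P _ _).mpr ⟨subset_rfl, trivial⟩
  have hT : IsClosed (P.support : Set X) := P.support.isClosed
  set M₁ : MarkedIdeal t.top := t.transformMarked M with hM₁
  have hsub₁ : M₁.support ⊆ t.comp ⁻¹' ((⟨I, [], b⟩ : MarkedIdeal X).support \ P.support) := by
    intro y hy
    refine ⟨CentreSeq.IsAdmissibleFor.support_transformMarked_subset_preimage t M htadm hy, fun hyP => ?_⟩
    rw [MarkedIdeal.mem_support_iff] at hy
    have htop : stalkIdeal M₁.ideal y = ⊤ := by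
      change stalkIdeal (controlledTransform (blowup.π P) P I b) y = ⊤
      exact stalkIdeal_controlledTransform_eq_top_of_stalkIdeal_eq_pow (blowup.π P) P I b (hIP _ hyP)
    rw [htop, top_le_iff, Ideal.eq_top_iff_one] at hy
    have h1 : (1 : t.top.presheaf.stalk y) ∈ maximalIdeal _ :=
      Ideal.pow_le_self (by rw [CentreSeq.transformMarked_mult]; change b ≠ 0; omega) hy
    exact (maximalIdeal.isMaximal _).ne_top (Ideal.eq_top_of_isUnit_mem _ h1 isUnit_one)
  have hfin : ((⟨I, [], b⟩ : MarkedIdeal X).support \ P.support).Finite := by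
    rw [hPsupp]
    exact finite_diff_closure_setOf_not_isClosed hF
  have hcl : ∀ y ∈ (⟨I, [], b⟩ : MarkedIdeal X).support \ (P.support : Set X), IsClosed ({y} : Set X) := by
    intro y hy
    rw [hPsupp] at hy
    by_contra h
    exact hy.2 (subset_closure ⟨hy.1, h⟩)
  have hinj : Set.InjOn t.comp M₁.support := fun y hy y' _ heq => by
    obtain ⟨z, -, hz⟩ := htover.exists_unique_comp_eq_of_not_mem hT (hsub₁ hy).2
    exact (hz y rfl).trans (hz y' heq.symm).symm
  have hfin₁ : M₁.support.Finite :=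
    Set.Finite.of_finite_image (hfin.subset (Set.image_subset_iff.mpr hsub₁)) hinj
  have hcl₁ : ∀ y ∈ M₁.support, IsClosed ({y} : Set t.top) := fun y hy =>
    htover.isClosed_singleton_of_comp_eq hT (hsub₁ hy).2 (hcl _ (hsub₁ hy)) rfl
  have hdim₁ : ∀ y ∈ M₁.support, ringKrullDim (t.top.presheaf.stalk y) ≤ 2 := fun y hy => by
    haveI := htover.isIso_stalkMap_comp_of_not_mem hT (hsub₁ hy).2
    rw [← ringKrullDim_eq_of_ringEquiv (asIso (t.comp.stalkMap y)).commRingCatIsoToRingEquiv]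
    exact (ringKrullDim_stalk_le_topologicalKrullDim X _).trans hX2
  exact ⟨P, htadm, hfin₁, hcl₁, hdim₁⟩

end Kollar2007

end Literature.AlgebraicGeometry.Resolution

end
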